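import Mathlib
import HarnessLib
import Summits.CriticalPhenomena.CardyFormulaZ2.Theorems.CardyComplexConeEdgeCoherenceMedialExplorationRotData
import Summits.CriticalPhenomena.CardyFormulaZ2.Theorems.CardyComplexConeEdgeCoherenceStubAliasing
import Summits.CriticalPhenomena.CardyFormulaZ2.Theorems.CardyComplexConeEdgeCoherenceLeeYangClassDefs

/-!
# `EdgeCoherence` as ROTATIONAL FORGETTING of the deep corner observable (crux stmt-CriticalPhenomena-11385)

Route `CardyComplexCone` (sub-problem `CriticalPhenomena/CardyFormulaZ2`), crux
`Summit.CriticalPhenomena.CardyFormulaZ2.Theses.CardyComplexCone.EdgeCoherence`; lead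
`prover-line-stmt-CriticalPhenomena-11385-c2-0` (line `Sketch`), reformulation built on the exact `ℤ₄` covariance
`Rotation.cornerObs_rotData_faceAt` (p151151): turning the Dobrushin DATA (domain and arcs) by a quarter turn about the
lattice point `v` maps the class-`c` corner value at `v` to the class-`(c+1)` corner value at `v` of the turned data,
EXACTLY, at every mesh. Consequently the four corner values at `v` agree to `o(δ^{1/3})` — i.e. `HarmonicVanishing`,
`EdgeCoherence` with the witness `u ≡ 1` — if and only if the corner observable at `v` FORGETS a quarter turn of the
far-away boundary data about `v`:

* `RotationalForgetting` — for every domain, family (guards), compact `K ⊂ D` and `ε > 0`, eventually in `δ`, at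
  every vertex `v` over `K` and every class `c`, `‖E_δ^{rotData (Λ δ) v}(v, faceAt v c) − E_δ^{Λ δ}(v, faceAt v c)‖ ≤ ε δ^{1/3}`;
* `rotationalForgetting_iff_harmonicVanishing : RotationalForgetting ↔ HarmonicVanishing` (pointwise finite Fourier
  algebra on `Fin 4`: consecutive classes agree ⟺ the three non-trivial harmonics vanish, constants `4` and `3/2`);
* `EdgeCoherence_of_rotationalForgetting : RotationalForgetting → EdgeCoherence` (through the landed
  `FixedRadiusCut.stub_aliasing`, p87880).

Reading. The rotational statement is the twin of clause (ii) of the sibling crux `EdgePrecompact`, which by the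
translation covariance `stub_translationCovariance` (stmt-CriticalPhenomena-11387) says that the corner observable
forgets a SMALL translation of the boundary data; here the motion of the far boundary is a quarter turn about the
point — not small: what makes it plausible is not locality but the conformal covariance of weight `1/3` of the
conjectured limit `(φ′)^{1/3}` (Duminil-Copin–Smirnov 2012, Conj. 8.7) together with the start-relative winding
convention of the tree's observable, under which the limit at the centre of rotation is INVARIANT. A refutation of
the crux is therefore exactly: a domain whose quarter turn about a deep point changes the corner observable at that
point at leading order `δ^{1/3}`.

References: H. Duminil-Copin, S. Smirnov, *Conformal invariance of lattice models*, Clay Math. Proc. 15 (2012) §8,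
Conj. 8.7; S. Smirnov, Ann. of Math. 172 (2010) §2.2; G. Grimmett, *Percolation* (1999) §1.6 (lattice symmetries).
-/

noncomputable section

namespace Summit.CriticalPhenomena.CardyFormulaZ2.Cruxes.EdgeCoherence.Rotation

open scoped BigOperators Topology
open Filter Set MeasureTheory
open Literature.Probability.LatticeModels Literature.Probability.RandomPlanarGeometry
open Literature.Probability.Percolation (BondConfig bondPercolation half)
open Summit.CriticalPhenomena.CardyFormulaZ2.Theses.CardyComplexCone (EdgeCoherence)
open Summit.CriticalPhenomena.CardyFormulaZ2.Cruxes.EdgeCoherence.FixedRadiusCut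
  (cornerObs harmonic HarmonicVanishing stub_aliasing)
open Summit.CriticalPhenomena.CardyFormulaZ2.Cruxes.EdgeCoherence.LeeYang (sum_I_pow_mul_eq_zero)

/-! ### The statement -/

/-- **ROTATIONAL FORGETTING of the corner observable** (nothing asserted): along every discretisation family of every
Dobrushin domain, on every compact `K ⊂ D`, for every `ε > 0`, eventually in `δ`: at every vertex `v` over `K` and
for every class `c : Fin 4`, the class-`c` corner value at `v` of the data turned by a quarter turn about `v`
(`rotData (Λ δ) v`: domain and both arcs turned about `meshPoint δ v`, same mesh) differs from that of the data by
at most `ε δ^{1/3}`. -/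
def RotationalForgetting : Prop :=
  ∀ (D : DobrushinDomain) (Λ : ℝ → DiscreteDobrushin), (∀ δ, (Λ δ).Ω = D.carrier) →
    (∀ δ, (Λ δ).δ = δ) → (∀ᶠ δ in 𝓝[>] (0:ℝ), (Λ δ).IsZdAdmissible) →
    ∀ K : Set ℂ, IsCompact K → K ⊆ D.carrier → ∀ ε > (0:ℝ), ∀ᶠ δ in 𝓝[>] (0:ℝ),
      ∀ v : Site 2, meshPoint δ v ∈ K → ∀ c : Fin 4,
        ‖cornerObs (rotData (Λ δ) v) δ v (faceAt v c) - cornerObs (Λ δ) δ v (faceAt v c)‖ ≤ ε * δ ^ ((1:ℝ) / 3)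

/-! ### Exact covariance at the centre of rotation -/

/-- At the centre `v` of the turn the class-`(c+1)` corner value of the turned data IS the class-`c` corner value
of the data (`cornerObs_rotData_faceAt` at `w = v`, `rotAbout_self`). -/
theorem cornerObs_rotData_self (E : DiscreteDobrushin) (δ : ℝ) (v : Site 2) (c : Fin 4) :
    cornerObs (rotData E v) δ v (faceAt v (c + 1)) = cornerObs E δ v (faceAt v c) := by
  simpa only [rotAbout_self] using cornerObs_rotData_faceAt E δ v v c

/-- Rotational forgetting at `(δ, v)`, read through the covariance: it compares CONSECUTIVE classes of the data,
`E_δ^{rotData E v}(v, faceAt v c) − E_δ^{E}(v, faceAt v c) = E_δ^{E}(v, faceAt v (c−1)) − E_δ^{E}(v, faceAt v c)`,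
here in the form with `c ↦ c + 1`. -/
theorem rot_sub_eq_consecutive (E : DiscreteDobrushin) (δ : ℝ) (v : Site 2) (c : Fin 4) :
    cornerObs (rotData E v) δ v (faceAt v (c + 1)) - cornerObs E δ v (faceAt v (c + 1)) =
      cornerObs E δ v (faceAt v c) - cornerObs E δ v (faceAt v (c + 1)) := by
  rw [cornerObs_rotData_self]

/-! ### Finite Fourier algebra on `Fin 4` -/

/-- **Consecutive differences control the harmonics**: if `‖F c − F (c+1)‖ ≤ η` for all `c : Fin 4` then
`‖Σ_c i^{kc} F c‖ ≤ 4η` for `k = 1, 2, 3` (`Σ_c i^{kc} = 0`, so the harmonic is `Σ_c i^{kc} (F c − F 0)`, and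
`‖F c − F 0‖ ≤ η, 2η, η` for `c = 1, 2, 3`). -/
theorem norm_harmonicSum_le_of_consecutive (F : Fin 4 → ℂ) {η : ℝ} (h : ∀ c : Fin 4, ‖F c - F (c + 1)‖ ≤ η)
    {k : ℕ} (hk : k ∈ ({1, 2, 3} : Finset ℕ)) : ‖∑ c : Fin 4, Complex.I ^ (k * (c : ℕ)) * F c‖ ≤ 4 * η := by
  have hsum : ∑ c : Fin 4, Complex.I ^ (k * (c : ℕ)) * F c =
      ∑ c : Fin 4, Complex.I ^ (k * (c : ℕ)) * (F c - F 0) := by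
    simp_rw [mul_sub, Finset.sum_sub_distrib, ← Finset.sum_mul, sum_I_pow_mul_eq_zero hk, zero_mul, sub_zero]
  have h10 : ‖F 1 - F 0‖ ≤ η := by rw [norm_sub_rev]; exact h 0
  have h21 : ‖F 2 - F 1‖ ≤ η := by rw [norm_sub_rev]; exact h 1
  have h30 : ‖F 3 - F 0‖ ≤ η := h 3
  have h20 : ‖F 2 - F 0‖ ≤ 2 * η := by
    calc ‖F 2 - F 0‖ = ‖(F 2 - F 1) + (F 1 - F 0)‖ := by ring_nf
      _ ≤ ‖F 2 - F 1‖ + ‖F 1 - F 0‖ := norm_add_le _ _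
      _ ≤ η + η := add_le_add h21 h10
      _ = 2 * η := by ring
  have hterm : ∀ c : Fin 4, ‖Complex.I ^ (k * (c : ℕ)) * (F c - F 0)‖ = ‖F c - F 0‖ := fun c => by
    rw [norm_mul, norm_pow, Complex.norm_I, one_pow, one_mul]
  rw [hsum]
  calc ‖∑ c : Fin 4, Complex.I ^ (k * (c : ℕ)) * (F c - F 0)‖
      ≤ ∑ c : Fin 4, ‖Complex.I ^ (k * (c : ℕ)) * (F c - F 0)‖ := norm_sum_le _ _
    _ = ∑ c : Fin 4, ‖F c - F 0‖ := Finset.sum_congr rfl fun c _ => hterm c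
    _ = ‖F 0 - F 0‖ + ‖F 1 - F 0‖ + ‖F 2 - F 0‖ + ‖F 3 - F 0‖ := by
        rw [Fin.sum_univ_four]
    _ ≤ 0 + η + 2 * η + η := by
        gcongr
        simp
    _ = 4 * η := by ring

/-- **The harmonics control consecutive differences** (finite Fourier inversion on `Fin 4`): if
`‖Σ_c i^{kc} F c‖ ≤ η` for `k = 1,2,3` then `‖F c − F (c+1)‖ ≤ (3/2) η` for every `c`
(`4(F c − F (c+1))` is a combination of the three harmonics with coefficients of modulus `≤ 2`). -/
theorem norm_consecutive_le_of_harmonicSum (F : Fin 4 → ℂ) {η : ℝ}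
    (h : ∀ k ∈ ({1, 2, 3} : Finset ℕ), ‖∑ c : Fin 4, Complex.I ^ (k * (c : ℕ)) * F c‖ ≤ η) (c : Fin 4) :
    ‖F c - F (c + 1)‖ ≤ 3 / 2 * η := by
  -- the three harmonics written out
  set H1 : ℂ := F 0 + Complex.I * F 1 - F 2 - Complex.I * F 3 with hH1
  set H2 : ℂ := F 0 - F 1 + F 2 - F 3 with hH2
  set H3 : ℂ := F 0 - Complex.I * F 1 - F 2 + Complex.I * F 3 with hH3
  have hI2 : Complex.I ^ 2 = -1 := Complex.I_sq
  have hI3 : Complex.I ^ 3 = -Complex.I := Complex.I_pow_three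
  have hI4 : Complex.I ^ 4 = 1 := Complex.I_pow_four
  have hI6 : Complex.I ^ 6 = -1 := by rw [show (6:ℕ) = 4 + 2 from rfl, pow_add, hI4, hI2]; ring
  have hI9 : Complex.I ^ 9 = Complex.I := by rw [show (9:ℕ) = 4 + 4 + 1 from rfl, pow_add, pow_add, hI4]; ring
  have e1 : ∑ c : Fin 4, Complex.I ^ (1 * (c : ℕ)) * F c = H1 := by
    simp [Fin.sum_univ_four, hI2, hI3, hH1]; ring
  have e2 : ∑ c : Fin 4, Complex.I ^ (2 * (c : ℕ)) * F c = H2 := by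
    simp [Fin.sum_univ_four, hI2, hI4, hI6, hH2]; ring
  have e3 : ∑ c : Fin 4, Complex.I ^ (3 * (c : ℕ)) * F c = H3 := by
    simp [Fin.sum_univ_four, hI3, hI6, hI9, hH3]; ring
  have b1 : ‖H1‖ ≤ η := e1 ▸ h 1 (by simp)
  have b2 : ‖H2‖ ≤ η := e2 ▸ h 2 (by simp)
  have b3 : ‖H3‖ ≤ η := e3 ▸ h 3 (by simp)
  have hη : 0 ≤ η := (norm_nonneg _).trans b1
  have nI : ‖(1 : ℂ) + Complex.I‖ ≤ 2 :=
    (norm_add_le _ _).trans (by rw [norm_one, Complex.norm_I]; norm_num)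
  have nI' : ‖(1 : ℂ) - Complex.I‖ ≤ 2 :=
    (norm_sub_le _ _).trans (by rw [norm_one, Complex.norm_I]; norm_num)
  have nI'' : ‖Complex.I - (1 : ℂ)‖ ≤ 2 :=
    (norm_sub_le _ _).trans (by rw [norm_one, Complex.norm_I]; norm_num)
  have nI''' : ‖-(1 : ℂ) - Complex.I‖ ≤ 2 :=
    (norm_sub_le _ _).trans (by rw [norm_neg, norm_one, Complex.norm_I]; norm_num)
  have n2 : ‖(2 : ℂ)‖ ≤ 2 := by norm_num
  have n2' : ‖(-2 : ℂ)‖ ≤ 2 := by norm_num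
  -- generic bound: if 4 X = a H1 + b H2 + d H3 with ‖a‖,‖b‖,‖d‖ ≤ 2 then ‖X‖ ≤ (3/2) η
  have key : ∀ (X a b d : ℂ), 4 * X = a * H1 + b * H2 + d * H3 → ‖a‖ ≤ 2 → ‖b‖ ≤ 2 → ‖d‖ ≤ 2 →
      ‖X‖ ≤ 3 / 2 * η := by
    intro X a b d hX ha hb hd
    have h4 : ‖(4:ℂ) * X‖ ≤ 2 * η + 2 * η + 2 * η := by
      rw [hX]
      calc ‖a * H1 + b * H2 + d * H3‖ ≤ ‖a * H1‖ + ‖b * H2‖ + ‖d * H3‖ := norm_add₃_le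
        _ = ‖a‖ * ‖H1‖ + ‖b‖ * ‖H2‖ + ‖d‖ * ‖H3‖ := by rw [norm_mul, norm_mul, norm_mul]
        _ ≤ 2 * η + 2 * η + 2 * η := by gcongr
    rw [norm_mul] at h4
    have : ‖(4:ℂ)‖ = 4 := by norm_num
    rw [this] at h4
    linarith
  fin_cases c
  · refine key (F 0 - F 1) (1 + Complex.I) 2 (1 - Complex.I) ?_ nI n2 nI'
    simp only [hH1, hH2, hH3]
    show (4 : ℂ) * (F 0 - F 1) = _
    ring_nf
    rw [hI2]; ring
  · refine key (F 1 - F 2) (1 - Complex.I) (-2) (1 + Complex.I) ?_ nI' n2' nI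
    simp only [hH1, hH2, hH3]
    show (4 : ℂ) * (F 1 - F 2) = _
    ring_nf
    rw [hI2]; ring
  · refine key (F 2 - F 3) (-1 - Complex.I) 2 (Complex.I - 1) ?_ nI''' n2 nI''
    simp only [hH1, hH2, hH3]
    show (4 : ℂ) * (F 2 - F 3) = _
    ring_nf
    rw [hI2]; ring
  · refine key (F 3 - F 0) (Complex.I - 1) (-2) (-1 - Complex.I) ?_ nI'' n2' nI'''
    simp only [hH1, hH2, hH3]
    show (4 : ℂ) * (F 3 - F 0) = _
    ring_nf
    rw [hI2]; ring

/-! ### The equivalence and the crux -/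

/-- **Rotational forgetting gives `HarmonicVanishing`** (run forgetting with `ε/4`; at `(δ, v)` the covariance turns it
into agreement of consecutive classes, `norm_harmonicSum_le_of_consecutive`). -/
theorem harmonicVanishing_of_rotationalForgetting : RotationalForgetting → HarmonicVanishing := by
  intro hR D Λ hΩ hδ hadm K hK hKD ε hε
  filter_upwards [hR D Λ hΩ hδ hadm K hK hKD (ε / 4) (by positivity)] with δ hRδ v hv k hk
  have hcons : ∀ c : Fin 4, ‖cornerObs (Λ δ) δ v (faceAt v c) - cornerObs (Λ δ) δ v (faceAt v (c + 1))‖ ≤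
      ε / 4 * δ ^ ((1:ℝ) / 3) := fun c => by
    rw [← rot_sub_eq_consecutive]
    exact hRδ v hv (c + 1)
  have := norm_harmonicSum_le_of_consecutive (fun c => cornerObs (Λ δ) δ v (faceAt v c)) hcons hk
  unfold FixedRadiusCut.harmonic
  linarith

/-- **`HarmonicVanishing` gives rotational forgetting** (run vanishing with `ε/2`; finite Fourier inversion
`norm_consecutive_le_of_harmonicSum` and the covariance). -/
theorem rotationalForgetting_of_harmonicVanishing : HarmonicVanishing → RotationalForgetting := by
  intro hH D Λ hΩ hδ hadm K hK hKD ε hε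
  filter_upwards [hH D Λ hΩ hδ hadm K hK hKD (ε / 2) (by positivity), self_mem_nhdsWithin]
    with δ hHδ hpos v hv c
  have hX : (0:ℝ) ≤ δ ^ ((1:ℝ) / 3) := Real.rpow_nonneg (le_of_lt hpos) _
  have hc : c = (c - 1) + 1 := (sub_add_cancel c 1).symm
  rw [hc, rot_sub_eq_consecutive]
  have h1 := norm_consecutive_le_of_harmonicSum (fun c => cornerObs (Λ δ) δ v (faceAt v c))
    (fun k hk => hHδ v hv k hk) (c - 1)
  have h2 : 3 / 2 * (ε / 2 * δ ^ ((1:ℝ) / 3)) ≤ ε * δ ^ ((1:ℝ) / 3) := by nlinarith [hX, hε]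
  exact h1.trans h2

/-- **`RotationalForgetting ↔ HarmonicVanishing`**: the corner observable forgets a quarter turn of the far boundary
data about the point iff its four classes agree to `o(δ^{1/3})`. -/
theorem rotationalForgetting_iff_harmonicVanishing : RotationalForgetting ↔ HarmonicVanishing :=
  ⟨harmonicVanishing_of_rotationalForgetting, rotationalForgetting_of_harmonicVanishing⟩

/-- **Rotational forgetting closes the crux**: `RotationalForgetting → EdgeCoherence` (witness `u ≡ 1`, through
the landed `stub_aliasing : HarmonicVanishing → EdgeCoherence`). [cite: DuminilCopinSmirnov2012Lattice, Conjecture 8.7] -/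
theorem EdgeCoherence_of_rotationalForgetting : RotationalForgetting → EdgeCoherence :=
  fun hR => stub_aliasing (harmonicVanishing_of_rotationalForgetting hR)

end Summit.CriticalPhenomena.CardyFormulaZ2.Cruxes.EdgeCoherence.Rotation

end
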